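import Literature.Probability.RandomPlanarGeometry.HalfPlaneAutomorphism
import HarnessLib

/-!
# Boundary rigidity of conformal parametrisations by the half-plane

Two conformal parametrisations `ψ₁, ψ₂ : ℍₒ → U` of the same domain `U ⊆ ℂ` by the open upper
half-plane `ℍₒ` which have the same boundary value `z` at `0` and the same boundary value `b` at
`∞` differ by a dilation, `ψ₂ = ψ₁ ∘ (w ↦ c w)` on `ℍₒ` for some `c > 0`
(`Literature.Probability.RandomPlanarGeometry.ConformalEquiv.exists_eqOn_comp_mul_of_boundaryValues`),
provided `ψ₁` has *some* boundary value at every real point, takes the boundary value `z` at the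
real point `0` only, and never takes the boundary value `b ≠ z` at a finite real point. This is
the form of "chordal SLE in `(U; z, b)` is well defined up to a linear time change" (Lawler (2005),
§6.1: the only Möbius self-maps of `ℍ` fixing `0` and `∞` are the dilations) that is used for the
domain Markov property, where `ψ₁` is a boundary extension of a slit map and no global
injectivity of the boundary correspondence is available (compare
`MarkedDomain.IsChordalUniformizing.exists_eq_trans_smul_of_disc` of `HalfPlaneAutomorphism`,
the same statement for Jordan domains from Carathéodory's theorem).

## Proof

The automorphism `M = ψ₁⁻¹ ∘ ψ₂` of `ℍₒ` satisfies `ψ₁ ∘ M = ψ₂`. A cluster point `x` of `M`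
along a filter on which `ψ₂ → q` is either interior, and then `ψ₁ x = q` (continuity of `ψ₁`),
or real, and then `q` is the boundary value of `ψ₁` at `x` (`ConformalEquiv.eq_of_mapClusterPt_trans_symm`);
and `ψ₁ → ψ₁ x` along a filter inside `ℍₒ` forces that filter to converge to `x` (continuity of
`ψ₁⁻¹` at `ψ₁ x ∈ U`, `ConformalEquiv.le_nhds_of_tendsto_apply`). Hence, as `w → 0`: `M` stays
bounded (otherwise `ψ₂ = ψ₁ ∘ M → b ≠ z` along a subfilter), an interior cluster point `x` would
have `𝓝[ℍₒ] 0 ≤ 𝓝 x`, i.e. `x = 0`, and a real one carries the boundary value `z`, so is `0`: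
`M → 0` (`tendsto_trans_symm_nhdsWithin_zero`). As `w → ∞`: a cluster point in a compact set
would be interior with `ψ₁ x = b`, forcing the filter at infinity to converge to `x`, or real
with boundary value `b`, both excluded: `M → ∞` (`tendsto_trans_symm_cocompact`). Then
`ConformalEquiv.exists_eqOn_smul_of_tendsto` (`HalfPlaneAutomorphism`) makes `M` a dilation.

## Mathlib

We USE `IsCompact.tendsto_nhds_of_unique_mapClusterPt`, `IsCompact.exists_mapClusterPt_of_frequently`,
`MapClusterPt.tendsto_comp'`, `Filter.push_pull`, `Filter.hasBasis_cocompact`,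
`disjoint_nhds_cocompact`.

## References

* G. F. Lawler, *Conformally Invariant Processes in the Plane*, AMS (2005), §6.1 (chordal SLE in
  a domain; "any other such `F̂` can be written as `r F` for some `r > 0`") and §6.3.
-/

open Set Filter Topology Complex Metric
open UpperHalfPlane (upperHalfPlaneSet isOpen_upperHalfPlaneSet)

noncomputable section

namespace Literature.Probability.RandomPlanarGeometry

namespace ConformalEquiv

variable {U : Set ℂ}

/-- `ψ₁ ∘ (ψ₁⁻¹ ∘ ψ₂) = ψ₂` eventually along any filter living on `ℍₒ`. [folklore] -/
theorem apply_trans_symm_eventuallyEq (ψ₁ ψ₂ : ConformalEquiv upperHalfPlaneSet U)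
    {l : Filter ℂ} (hl : ∀ᶠ w in l, w ∈ upperHalfPlaneSet) :
    (ψ₁ ∘ (ψ₂.trans ψ₁.symm)) =ᶠ[l] ψ₂ := by
  filter_upwards [hl] with w hw
  rw [Function.comp_apply, trans_apply]
  exact ψ₁.apply_symm_apply (ψ₂.mapsTo hw)

/-- **Cluster points of `ψ₁⁻¹ ∘ ψ₂` see the limits of `ψ₂` through `ψ₁`.** If `x` is a cluster
point of `M = ψ₁⁻¹ ∘ ψ₂` along a filter `l` on `ℍₒ` on which `ψ₂ → q`, and `ψ₁ → p` at `x` within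
`ℍₒ`, then `p = q` (`ψ₁ ∘ M = ψ₂` clusters both at `p` and only at `q`). [folklore] -/
theorem eq_of_mapClusterPt_trans_symm (ψ₁ ψ₂ : ConformalEquiv upperHalfPlaneSet U)
    {l : Filter ℂ} (hl : ∀ᶠ w in l, w ∈ upperHalfPlaneSet) {x p q : ℂ}
    (hx : MapClusterPt x l (ψ₂.trans ψ₁.symm))
    (hp : Tendsto ψ₁ (𝓝[upperHalfPlaneSet] x) (𝓝 p)) (hq : Tendsto ψ₂ l (𝓝 q)) : p = q := by
  set M : ConformalEquiv upperHalfPlaneSet upperHalfPlaneSet := ψ₂.trans ψ₁.symm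
  have hM : ∀ᶠ w in l, M w ∈ upperHalfPlaneSet := hl.mono fun w hw ↦ M.mapsTo hw
  have hle : 𝓝 x ⊓ map M l ≤ 𝓝[upperHalfPlaneSet] x :=
    le_inf inf_le_left (inf_le_right.trans (le_principal_iff.2 (mem_map.2 hM)))
  have h1 : MapClusterPt p l (ψ₁ ∘ M) := hx.tendsto_comp' (hp.mono_left hle)
  have h2 : Tendsto (ψ₁ ∘ M) l (𝓝 q) :=
    hq.congr' (apply_trans_symm_eventuallyEq ψ₁ ψ₂ hl).symm
  exact t2_iff_nhds.1 inferInstance (h1.clusterPt.mono h2)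

/-- **Continuity of `ψ⁻¹` at an interior value, filter form.** If `x ∈ ℍₒ` and `ψ → ψ x` along a
filter `l` living on `ℍₒ`, then `l` converges to `x` (apply the continuous inverse `ψ⁻¹` on `U`
at `ψ x ∈ U`). [folklore] -/
theorem le_nhds_of_tendsto_apply (ψ : ConformalEquiv upperHalfPlaneSet U) {l : Filter ℂ}
    (hl : ∀ᶠ w in l, w ∈ upperHalfPlaneSet) {x : ℂ} (hx : x ∈ upperHalfPlaneSet)
    (h : Tendsto ψ l (𝓝 (ψ x))) : l ≤ 𝓝 x := by
  have h1 : Tendsto ψ l (𝓝[U] (ψ x)) :=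
    tendsto_nhdsWithin_iff.2 ⟨h, hl.mono fun w hw ↦ ψ.mapsTo hw⟩
  have h2 : Tendsto (ψ.symm ∘ ψ) l (𝓝 (ψ.symm (ψ x))) :=
    (ψ.symm.continuousOn (ψ x) (ψ.mapsTo hx)).tendsto.comp h1
  rw [ψ.symm_apply_apply hx] at h2
  have h3 : (ψ.symm ∘ ψ) =ᶠ[l] id := hl.mono fun w hw ↦ ψ.symm_apply_apply hw
  exact tendsto_id'.1 (h2.congr' h3)

/-- **`ψ₁⁻¹ ∘ ψ₂ → 0` at `0`.** Under the hypotheses of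
`exists_eqOn_comp_mul_of_boundaryValues`, the automorphism `M = ψ₁⁻¹ ∘ ψ₂` of `ℍₒ` tends to `0`
as `w → 0` within `ℍₒ`: `M` is bounded near `0` (else `ψ₂ = ψ₁ ∘ M → b` along a subfilter, but
`ψ₂ → z ≠ b`), and every cluster point `x` of `M` at `0` is `0` — an interior one has `ψ₁ x = z`,
whence `𝓝[ℍₒ] 0 ≤ 𝓝 x`; a real one carries the boundary value `z` of `ψ₁`, whence `x = 0` by
uniqueness. Lawler (2005), §6.1. [folklore] -/
theorem tendsto_trans_symm_nhdsWithin_zero (ψ₁ ψ₂ : ConformalEquiv upperHalfPlaneSet U) {z b : ℂ}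
    (hbv : ∀ x : ℝ, ∃ p, ψ₁.HasBoundaryValue x p)
    (h0₁ : ψ₁.HasBoundaryValue 0 z) (h0₂ : ψ₂.HasBoundaryValue 0 z)
    (hinf₁ : ψ₁.HasBoundaryValueAtInfty b)
    (huniq : ∀ x : ℝ, ψ₁.HasBoundaryValue x z → x = 0) (hzb : z ≠ b) :
    Tendsto (ψ₂.trans ψ₁.symm) (𝓝[upperHalfPlaneSet] 0) (𝓝 0) := by
  set M : ConformalEquiv upperHalfPlaneSet upperHalfPlaneSet := ψ₂.trans ψ₁.symm
  set L : Filter ℂ := 𝓝[upperHalfPlaneSet] (0 : ℂ)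
  have hL : ∀ᶠ w in L, w ∈ upperHalfPlaneSet := self_mem_nhdsWithin
  have hML : ∀ᶠ w in L, M w ∈ upperHalfPlaneSet := hL.mono fun w hw ↦ M.mapsTo hw
  -- Step 1: `M` is bounded near `0`
  have hdisj : Disjoint (map M L) (cocompact ℂ) := by
    rw [disjoint_iff, ← Filter.push_pull, map_eq_bot_iff]
    by_contra hne
    haveI : NeBot (L ⊓ comap M (cocompact ℂ)) := ⟨hne⟩
    have h1 : Tendsto M (L ⊓ comap M (cocompact ℂ)) (cocompact ℂ ⊓ 𝓟 upperHalfPlaneSet) :=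
      tendsto_inf.2 ⟨tendsto_comap.mono_left inf_le_right,
        tendsto_principal.2 (hML.filter_mono inf_le_left)⟩
    have h2 : Tendsto (ψ₁ ∘ M) (L ⊓ comap M (cocompact ℂ)) (𝓝 b) := hinf₁.comp h1
    have h3 : Tendsto ψ₂ (L ⊓ comap M (cocompact ℂ)) (𝓝 z) := h0₂.mono_left inf_le_left
    have h4 : Tendsto ψ₂ (L ⊓ comap M (cocompact ℂ)) (𝓝 b) :=
      h2.congr' (apply_trans_symm_eventuallyEq ψ₁ ψ₂ (hL.filter_mono inf_le_left))
    exact hzb (tendsto_nhds_unique h3 h4)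
  obtain ⟨K, hK, hKL⟩ := (hasBasis_cocompact.disjoint_iff_right).1 hdisj
  rw [compl_compl] at hKL
  -- Step 2: every cluster point of `M` at `0` in the compact set `K ∩ closure ℍₒ` is `0`
  have hK' : IsCompact (K ∩ closure upperHalfPlaneSet) := hK.inter_right isClosed_closure
  have hmem : ∀ᶠ w in L, M w ∈ K ∩ closure upperHalfPlaneSet :=
    (show ∀ᶠ w in L, M w ∈ K from hKL).and (hML.mono fun w hw ↦ subset_closure hw)
  refine hK'.tendsto_nhds_of_unique_mapClusterPt hmem fun x hx hclust ↦ ?_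
  have hxim : 0 ≤ x.im := mem_closure_upperHalfPlaneSet_iff.1 hx.2
  rcases hxim.lt_or_eq with hpos | hzero
  · -- interior cluster point: `ψ₁ x = z`, so `𝓝[ℍₒ] 0 ≤ 𝓝 x`, so `x = 0`
    have hxH : x ∈ upperHalfPlaneSet := hpos
    have h1 : ψ₁ x = z :=
      eq_of_mapClusterPt_trans_symm ψ₁ ψ₂ hL hclust (ψ₁.continuousOn x hxH) h0₂
    have h2 : L ≤ 𝓝 x := le_nhds_of_tendsto_apply ψ₁ hL hxH (h1 ▸ h0₁)
    haveI := neBot_nhdsWithin_upperHalfPlaneSet_zero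
    exact tendsto_nhds_unique (tendsto_id'.2 h2) (tendsto_id'.2 (nhdsWithin_le_nhds (a := (0 : ℂ))))
  · -- real cluster point: `ψ₁` has boundary value `z` at `x`, so `x = 0`
    have hxre : ((x.re : ℝ) : ℂ) = x := Complex.ext (by simp) (by simp [hzero])
    obtain ⟨p, hp⟩ := hbv x.re
    have h1 : p = z :=
      eq_of_mapClusterPt_trans_symm ψ₁ ψ₂ hL hclust (by rw [← hxre]; exact hp) h0₂
    subst h1
    have h2 : x.re = 0 := huniq x.re hp
    rw [← hxre, h2, ofReal_zero]

/-- **`ψ₁⁻¹ ∘ ψ₂ → ∞` at `∞`.** Under the hypotheses of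
`exists_eqOn_comp_mul_of_boundaryValues`, the automorphism `M = ψ₁⁻¹ ∘ ψ₂` of `ℍₒ` tends to
`∞` as `w → ∞` within `ℍₒ`: a cluster point `x` of `M` at infinity inside a compact set would
be interior with `ψ₁ x = b`, forcing the (non-trivial) filter at infinity on `ℍₒ` to converge
to `x`, or real with `b` a boundary value of `ψ₁` at `x`, which is excluded.
Lawler (2005), §6.1. [folklore] -/
theorem tendsto_trans_symm_cocompact (ψ₁ ψ₂ : ConformalEquiv upperHalfPlaneSet U) {b : ℂ}
    (hbv : ∀ x : ℝ, ∃ p, ψ₁.HasBoundaryValue x p)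
    (hinf₁ : ψ₁.HasBoundaryValueAtInfty b) (hinf₂ : ψ₂.HasBoundaryValueAtInfty b)
    (hb : ∀ x : ℝ, ¬ ψ₁.HasBoundaryValue x b) :
    Tendsto (ψ₂.trans ψ₁.symm) (cocompact ℂ ⊓ 𝓟 upperHalfPlaneSet) (cocompact ℂ) := by
  set M : ConformalEquiv upperHalfPlaneSet upperHalfPlaneSet := ψ₂.trans ψ₁.symm
  set L : Filter ℂ := cocompact ℂ ⊓ 𝓟 upperHalfPlaneSet
  have hL : ∀ᶠ w in L, w ∈ upperHalfPlaneSet := mem_inf_of_right (mem_principal_self _)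
  have hML : ∀ᶠ w in L, M w ∈ upperHalfPlaneSet := hL.mono fun w hw ↦ M.mapsTo hw
  rw [hasBasis_cocompact.tendsto_right_iff]
  intro K hK
  by_contra hnot
  have hfr : ∃ᶠ w in L, M w ∈ K ∩ closure upperHalfPlaneSet := by
    have h1 : ∃ᶠ w in L, M w ∈ K := by
      simpa only [mem_compl_iff, not_not] using not_eventually.1 hnot
    exact (h1.and_eventually hML).mono fun w hw ↦ ⟨hw.1, subset_closure hw.2⟩
  obtain ⟨x, hx, hclust⟩ :=
    (hK.inter_right isClosed_closure).exists_mapClusterPt_of_frequently hfr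
  have hxim : 0 ≤ x.im := mem_closure_upperHalfPlaneSet_iff.1 hx.2
  have hb₂ : Tendsto ψ₂ L (𝓝 b) := hinf₂
  rcases hxim.lt_or_eq with hpos | hzero
  · -- interior cluster point: `ψ₁ x = b`, so the filter at infinity converges to `x`
    have hxH : x ∈ upperHalfPlaneSet := hpos
    have h1 : ψ₁ x = b :=
      eq_of_mapClusterPt_trans_symm ψ₁ ψ₂ hL hclust (ψ₁.continuousOn x hxH) hb₂
    have h2 : L ≤ 𝓝 x := le_nhds_of_tendsto_apply ψ₁ hL hxH (h1 ▸ hinf₁)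
    haveI := neBot_cocompact_inf_principal_upperHalfPlaneSet
    exact (tendsto_id'.2 h2).not_tendsto (disjoint_nhds_cocompact x) (tendsto_id'.2 inf_le_left)
  · -- real cluster point: `ψ₁` would have boundary value `b` at `x`
    have hxre : ((x.re : ℝ) : ℂ) = x := Complex.ext (by simp) (by simp [hzero])
    obtain ⟨p, hp⟩ := hbv x.re
    have h1 : p = b :=
      eq_of_mapClusterPt_trans_symm ψ₁ ψ₂ hL hclust (by rw [← hxre]; exact hp) hb₂
    subst h1
    exact hb x.re hp

/-- **Boundary rigidity of conformal parametrisations by the half-plane.** Let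
`ψ₁, ψ₂ : ℍₒ → U` be conformal equivalences with the same boundary value `z` at `0` and the
same boundary value `b ≠ z` at `∞`; assume `ψ₁` has a boundary value at every real point, has
the boundary value `z` at the real point `0` only, and does not have the boundary value `b` at
any real point. Then `ψ₂ = ψ₁ ∘ (w ↦ c w)` on `ℍₒ` for some real `c > 0`: the automorphism
`ψ₁⁻¹ ∘ ψ₂` of `ℍₒ` fixes the boundary points `0` and `∞` (`tendsto_trans_symm_nhdsWithin_zero`,
`tendsto_trans_symm_cocompact`), hence is a dilation (`exists_eqOn_smul_of_tendsto`).
Lawler (2005), §6.1 (chordal SLE in `(D; z, w)` is defined via any conformal `F` with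
`F(z) = 0`, `F(w) = ∞`, and "any other such `F̂` can be written as `r F` for some `r > 0`").
[cite: Lawler2005, §6.1] -/
theorem exists_eqOn_comp_mul_of_boundaryValues {U : Set ℂ}
    (ψ₁ ψ₂ : ConformalEquiv upperHalfPlaneSet U) {z b : ℂ}
    (hbv : ∀ x : ℝ, ∃ p, ψ₁.HasBoundaryValue x p)
    (h0₁ : ψ₁.HasBoundaryValue 0 z) (h0₂ : ψ₂.HasBoundaryValue 0 z)
    (hinf₁ : ψ₁.HasBoundaryValueAtInfty b) (hinf₂ : ψ₂.HasBoundaryValueAtInfty b)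
    (huniq : ∀ x : ℝ, ψ₁.HasBoundaryValue x z → x = 0) (hzb : z ≠ b)
    (hb : ∀ x : ℝ, ¬ ψ₁.HasBoundaryValue x b) :
    ∃ c : ℝ, 0 < c ∧ EqOn ψ₂ (fun w ↦ ψ₁ ((c : ℂ) * w)) upperHalfPlaneSet := by
  set M : ConformalEquiv upperHalfPlaneSet upperHalfPlaneSet := ψ₂.trans ψ₁.symm with hM
  have h0 : Tendsto M (𝓝[upperHalfPlaneSet] 0) (𝓝 0) :=
    tendsto_trans_symm_nhdsWithin_zero ψ₁ ψ₂ hbv h0₁ h0₂ hinf₁ huniq hzb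
  have hinf : Tendsto M (cocompact ℂ ⊓ 𝓟 upperHalfPlaneSet) (cocompact ℂ) :=
    tendsto_trans_symm_cocompact ψ₁ ψ₂ hbv hinf₁ hinf₂ hb
  obtain ⟨c, hc, hMc⟩ := M.exists_eqOn_smul_of_tendsto h0 hinf
  refine ⟨c, hc, fun w hw ↦ ?_⟩
  have hMw : ψ₁.symm (ψ₂ w) = (c : ℂ) * w := hMc hw
  show ψ₂ w = ψ₁ ((c : ℂ) * w)
  rw [← hMw, ψ₁.apply_symm_apply (ψ₂.mapsTo hw)]

end ConformalEquiv

end Literature.Probability.RandomPlanarGeometry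

end
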